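/-
Copyright (c) 2026 the pub-hodgecm-mathlib formalisation cell (harness21).  Prover seat hodgecm-mathlib-K2E3-p23 (g8), Track B «K2-LIT» ∕ hLiu418 #184♮,
Road I v3, unit U5 «THE CLOSE», FACE-D₀ row `h2₂`: THE S-LETTERS OF ★ U2a's σ-EXPLICIT LINE MODEL AT ONE FINITE PLACE `v` — PART 2a, THE LETTER `hb`
(the hermitian dressing `b z = δ • X_v(z) T_v⁻¹` is ONTO the `σ ⊗ 1`-hermitian `2 × 2` matrices).  THEOREMS ONLY.
-/
import Summits.HodgeConjecture.HodgeConjecture.Theorems.K2LiuFinLineModelLettersAtPlace   -- ★ p864061 PART 1 (brings ★ p863656 the local chart, ★ p863445 §1, ★ (d1))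
import HarnessLib

/-!
# K2_Liu road (hLiu418 = stmt-HodgeConjecture-24832), U5 «THE CLOSE», FACE-D₀ row `h2₂`: THE LETTER `hb` OF ★ U2a's LINE MODEL AT THE PLACE `v`

Cell `pub/hodgecm-mathlib` (D-0151), Track B, build stream 29; helper lane `--supports stmt-HodgeConjecture-24832 --as helper`, count-neutral; closes no socket.
THEOREMS ONLY (no `def`, no `instance`, no notation, no named-fact hypothesis, no `sorry`).

★ U2a's letter `hb : ∀ s, (s.map σ)ᵀ = s → ∃ z, b z = s` at the instance of ★ p864061 PART 1 (`b z := reindex ρ ρ (δ • (X_v(z) · T_v⁻¹))`, `X_v(z) = X(ι_v z)|_v`):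
given a `σ ⊗ 1`-hermitian `s ∈ M₂(L ⊗ L⁺_v)`, the matrix `Y := (δ⁻¹ • reindex ρ⁻¹ ρ⁻¹ s) · T_v` is `T_v`-skew (§2), its PLACE-`v` LIFT `Ỹ := (Σ_{w∣v} ι_w(Y_w))` to `M_n(𝔸_L)`
(★ p863445 §1) has zero archimedean part, vanishes off `v`, restricts to `Y` over `v` (§1) and is `T_𝔸`-skew — checked COMPONENTWISE with ★ `matrix_adele_ext_of_places`
(§2: archimedean part `0`; places `∤ v`: `0`, using `((c ⊗ 1) x)_u = c_* x_{c⁻¹u}` ★ `conjFiniteAdele_apply_apply`; places `∣ v`: the local skewness through ★ `finiteAdeleToLocal_conj`);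
so ★ p863656 `exists_mem_unipDeltaLoc_toBlocks₁₂_eq` produces `z ∈ N_Δ(L⁺_v)` with `X(ι_v z) = Ỹ`, whence `X_v(z) = Y` and `b z = reindex ρ ρ (δ δ⁻¹ • reindex ρ⁻¹ ρ⁻¹ s) = s` (§3
**`exists_unipDeltaLoc_dressing_eq`** = `hb`).
References: [GelbartPiatetskishapiroRallis1987] Part A §1; [MoeglinWaldspurger1995] I.2.1; [CasselsFrohlichANT1967] Ch. II §14; [Scharlau1985HermitianForms] Ch. 10 §1.
HONEST LABEL: HC_CM is proved only modulo the 7 printed citations (2 remaining named inputs: hLiu418 = stmt-HodgeConjecture-24832, h413 = stmt-HodgeConjecture-24833)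
until rung 0 closes; this file moves no counter; `h2₂` NOT discharged.
-/

set_option autoImplicit false
set_option linter.dupNamespace false -- the mandated namespace repeats `HodgeConjecture.HodgeConjecture`

noncomputable section

open scoped Matrix
open NumberField IsDedekindDomain
open Literature.NumberTheory.Automorphic Literature.NumberTheory.Automorphic.UnitaryGroup Literature.NumberTheory.GaloisRepresentations
open Literature.NumberTheory.GelbartRogawski1991 Literature.NumberTheory.GelbartRogawski1991.GRConstruction
open Literature.NumberTheory.GelbartRogawski1991.UnitaryDualPair (imagUnit imagUnitSq complexConj_imagUnit imagUnit_ne_zero imagUnit_mul_self)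
open Literature.NumberTheory.K2Lit.SiegelDoubled

namespace Summit.HodgeConjecture.HodgeConjecture.Cruxes.HLiu418.K2LiuFinLineModelLettersAtPlaceB

open K2LiuSiegelUnipotentLocalDefs (unipDeltaLoc locToAdelic_mem_unipDelta)
open K2LiuAdeleAddCharTower (fst_sum_adeleSingleHom adeleEval_sum_adeleSingleHom_of_over adeleEval_sum_adeleSingleHom_of_not_over)
open K2LiuUnipotentChartLocal (matrix_adele_ext_of_places exists_mem_unipDeltaLoc_toBlocks₁₂_eq)
open K2LiuFinLineModelLettersAtPlace (localGram_map_conj_transpose_isUnit)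

variable (L : Type) [Field L] [NumberField L] [IsCMField L]
variable {N M n : ℕ} (e : Fin N × Fin M ≃ Fin n)
  (dV : Fin N → L) (hdV : ∀ i, IsCMField.complexConj L (dV i) = dV i)
  (dW : Fin M → L) (hdW : ∀ i, IsCMField.complexConj L (dW i) = dW i)
  (v : HeightOneSpectrum (𝓞 (Fp L)))

/-! ## §1 The place-`v` lift `Ỹ = (Σ_{w∣v} ι_w(Y_w))` of a local matrix: components -/
section Lift

variable {ι : Type*}

omit [IsCMField L] in
/-- the lift has zero archimedean part. [cite: CasselsFrohlichANT1967, Ch. II §14] -/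
theorem map_adeleFst_lift (Y : Matrix ι ι (LocalRing L v)) :
    (Y.map fun y : LocalRing L v => ∑ w : UnitaryGroup.PlacesOver L v, adeleSingleHom L w.1 (y w)).map (UnitaryGroup.adeleFst L) = 0 :=
  Matrix.ext fun i j => fst_sum_adeleSingleHom (Fp L) L v (Y i j)

omit [IsCMField L] in
/-- the lift vanishes at the finite places not over `v`. [cite: CasselsFrohlichANT1967, Ch. II §14] -/
theorem map_adeleEval_lift_of_not_over (Y : Matrix ι ι (LocalRing L v)) (u : HeightOneSpectrum (𝓞 L)) (hu : u.under (𝓞 (Fp L)) ≠ v) :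
    (Y.map fun y : LocalRing L v => ∑ w : UnitaryGroup.PlacesOver L v, adeleSingleHom L w.1 (y w)).map (AdelicGroupData.adeleEval L u) = 0 :=
  Matrix.ext fun i j => adeleEval_sum_adeleSingleHom_of_not_over (Fp L) L v (Y i j) u hu

omit [IsCMField L] in
/-- the lift restricts to `Y_u` at a place `u ∣ v`. [cite: CasselsFrohlichANT1967, Ch. II §14] -/
theorem map_adeleEval_lift_of_over (Y : Matrix ι ι (LocalRing L v)) (u : HeightOneSpectrum (𝓞 L)) (hu : u.under (𝓞 (Fp L)) = v) :
    (Y.map fun y : LocalRing L v => ∑ w : UnitaryGroup.PlacesOver L v, adeleSingleHom L w.1 (y w)).map (AdelicGroupData.adeleEval L u) =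
      Y.map (Pi.evalRingHom (fun w : UnitaryGroup.PlacesOver L v => w.1.adicCompletion L) ⟨u, hu⟩) :=
  Matrix.ext fun i j => adeleEval_sum_adeleSingleHom_of_over (Fp L) L v (Y i j) u hu

omit [IsCMField L] in
/-- the lift restricts to `Y` over `v`. [cite: CasselsFrohlichANT1967, Ch. II §14] -/
theorem map_local_lift (Y : Matrix ι ι (LocalRing L v)) :
    (Y.map fun y : LocalRing L v => ∑ w : UnitaryGroup.PlacesOver L v, adeleSingleHom L w.1 (y w)).map
        (fun x : AdeleRing (𝓞 L) L => finiteAdeleToLocal L v x.2) = Y :=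
  Matrix.ext fun i j => funext fun w => adeleEval_sum_adeleSingleHom_of_over (Fp L) L v (Y i j) w.1 w.2

/-- the conjugate `(c ⊗ 1) Ỹ` of the lift has zero archimedean part. [cite: CasselsFrohlichANT1967, Ch. II §14] -/
theorem map_adeleFst_conj_lift (Y : Matrix ι ι (LocalRing L v)) :
    ((Y.map fun y : LocalRing L v => ∑ w : UnitaryGroup.PlacesOver L v, adeleSingleHom L w.1 (y w)).map
        (conjAdele (Fp L) L (IsCMField.complexConj L))).map (UnitaryGroup.adeleFst L) = 0 :=
  Matrix.ext fun i j => by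
    show (conjAdele (Fp L) L (IsCMField.complexConj L) (∑ w : UnitaryGroup.PlacesOver L v, adeleSingleHom L w.1 (Y i j w))).1 = 0
    rw [conjAdele_apply, AdeleRing.smul_fst, fst_sum_adeleSingleHom, smul_zero]

/-- `(c ⊗ 1) Ỹ` vanishes at the finite places not over `v` (`((c ⊗ 1) x)_u = c_* (x_{c⁻¹ u})`, and `c⁻¹ u ∤ v`). [cite: CasselsFrohlichANT1967, Ch. VII §1.1] -/
theorem map_adeleEval_conj_lift_of_not_over (Y : Matrix ι ι (LocalRing L v)) (u : HeightOneSpectrum (𝓞 L)) (hu : u.under (𝓞 (Fp L)) ≠ v) :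
    ((Y.map fun y : LocalRing L v => ∑ w : UnitaryGroup.PlacesOver L v, adeleSingleHom L w.1 (y w)).map
        (conjAdele (Fp L) L (IsCMField.complexConj L))).map (AdelicGroupData.adeleEval L u) = 0 :=
  Matrix.ext fun i j => by
    have hu' : ((IsCMField.complexConj L : L ≃ₐ[Fp L] L)⁻¹ • u).under (𝓞 (Fp L)) ≠ v := by
      rwa [HeightOneSpectrum.under_algEquiv_smul]
    show (conjAdele (Fp L) L (IsCMField.complexConj L) (∑ w : UnitaryGroup.PlacesOver L v, adeleSingleHom L w.1 (Y i j w))).2 u = 0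
    rw [conjAdele_snd, conjFiniteAdele_apply_apply, adeleEval_sum_adeleSingleHom_of_not_over (Fp L) L v _ _ hu', map_zero]

/-- over `v`, `(c ⊗ 1) Ỹ` restricts to `(σ ⊗ 1) Y` (★ `finiteAdeleToLocal_conj`). [cite: CasselsFrohlichANT1967, Ch. II §14] -/
theorem map_adeleEval_conj_lift_of_over (Y : Matrix ι ι (LocalRing L v)) (u : HeightOneSpectrum (𝓞 L)) (hu : u.under (𝓞 (Fp L)) = v) :
    ((Y.map fun y : LocalRing L v => ∑ w : UnitaryGroup.PlacesOver L v, adeleSingleHom L w.1 (y w)).map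
        (conjAdele (Fp L) L (IsCMField.complexConj L))).map (AdelicGroupData.adeleEval L u) =
      (Y.map (conjLocal L (IsCMField.complexConj L) v)).map (Pi.evalRingHom (fun w : UnitaryGroup.PlacesOver L v => w.1.adicCompletion L) ⟨u, hu⟩) :=
  Matrix.ext fun i j => by
    show (conjAdele (Fp L) L (IsCMField.complexConj L) (∑ w : UnitaryGroup.PlacesOver L v, adeleSingleHom L w.1 (Y i j w))).2 u =
      conjLocal L (IsCMField.complexConj L) v (Y i j) ⟨u, hu⟩
    have h := congrFun (finiteAdeleToLocal_conj L (IsCMField.complexConj L) v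
      (∑ w : UnitaryGroup.PlacesOver L v, adeleSingleHom L w.1 (Y i j w)).2) ⟨u, hu⟩
    rw [finiteAdeleToLocal_apply] at h
    have hY : finiteAdeleToLocal L v (∑ w : UnitaryGroup.PlacesOver L v, adeleSingleHom L w.1 (Y i j w)).2 = Y i j :=
      funext fun w => adeleEval_sum_adeleSingleHom_of_over (Fp L) L v (Y i j) w.1 w.2
    rw [hY] at h
    rw [conjAdele_snd]
    exact h

/-- over `v`, the adelic Gram matrix `T_𝔸 = gramR ⊗ 1` restricts to the local one `T_v`. [cite: GelbartRogawski1991, §3.1 Prop. 3.1.1 p. 455 L1–2] -/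
theorem map_adeleEval_gram_of_over (u : HeightOneSpectrum (𝓞 L)) (hu : u.under (𝓞 (Fp L)) = v) :
    ((gramR L e dV hdV dW hdW).map ((algebraMap L (AdeleRing (𝓞 L) L)).comp (algebraMap (Fp L) L))).map (AdelicGroupData.adeleEval L u) =
      (((gramR L e dV hdV dW hdW).map (algebraMap (Fp L) L)).map (algebraMap L (LocalRing L v))).map (Pi.evalRingHom (fun w : UnitaryGroup.PlacesOver L v => w.1.adicCompletion L) ⟨u, hu⟩) :=
  Matrix.ext fun i j => by
    simp only [Matrix.map_apply, RingHom.comp_apply]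
    rw [K2LiuTateCharacterLocalTrace.adeleEval_algebraMap_eq_coe]
    rfl

end Lift

/-! ## §2 The lift of a `T_v`-skew matrix is `T_𝔸`-skew -/

/-- **the place-`v` lift of a `T_v`-skew local matrix is `T_𝔸`-skew** (componentwise: archimedean part `0`; finite places `∤ v`: `0`; places `∣ v`: the local
skewness), in the spelling of ★ p863656 `exists_mem_unipDeltaLoc_toBlocks₁₂_eq`'s hypothesis `hX`. [cite: GelbartPiatetskishapiroRallis1987, Part A §1]
[cite: MoeglinWaldspurger1995, I.2.1] -/
theorem lift_skew (Y : Matrix (Fin n) (Fin n) (LocalRing L v))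
    (hY : ((gramR L e dV hdV dW hdW).map (algebraMap (Fp L) L)).map (algebraMap L (LocalRing L v)) * Y +
      (Y.map (conjLocal L (IsCMField.complexConj L) v))ᵀ * ((gramR L e dV hdV dW hdW).map (algebraMap (Fp L) L)).map (algebraMap L (LocalRing L v)) = 0) :
    (gramR L e dV hdV dW hdW).map ((algebraMap L (AdeleRing (𝓞 L) L)).comp (algebraMap (Fp L) L)) *
        (Y.map fun y : LocalRing L v => ∑ w : UnitaryGroup.PlacesOver L v, adeleSingleHom L w.1 (y w)) +
      ((Y.map fun y : LocalRing L v => ∑ w : UnitaryGroup.PlacesOver L v, adeleSingleHom L w.1 (y w)).map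
          (conjAdele (Fp L) L (IsCMField.complexConj L)))ᵀ *
        (gramR L e dV hdV dW hdW).map ((algebraMap L (AdeleRing (𝓞 L) L)).comp (algebraMap (Fp L) L)) = 0 := by
  refine matrix_adele_ext_of_places L ?_ fun u => ?_
  · rw [Matrix.map_add _ (map_add _), Matrix.map_mul, Matrix.map_mul, Matrix.transpose_map, map_adeleFst_lift, map_adeleFst_conj_lift,
      Matrix.mul_zero, Matrix.transpose_zero, Matrix.zero_mul, add_zero, Matrix.map_zero _ (map_zero _)]
  · by_cases hu : u.under (𝓞 (Fp L)) = v
    · have h := congrArg (fun A : Matrix (Fin n) (Fin n) (LocalRing L v) => A.map (Pi.evalRingHom (fun w : UnitaryGroup.PlacesOver L v => w.1.adicCompletion L) ⟨u, hu⟩)) hY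
      simp only at h
      rw [Matrix.map_add _ (map_add _), Matrix.map_mul, Matrix.map_mul, Matrix.transpose_map, Matrix.map_zero _ (map_zero _)] at h
      rw [Matrix.map_add _ (map_add _), Matrix.map_mul, Matrix.map_mul, Matrix.transpose_map, map_adeleEval_lift_of_over L v Y u hu,
        map_adeleEval_conj_lift_of_over L v Y u hu, map_adeleEval_gram_of_over L e dV hdV dW hdW v u hu, Matrix.map_zero _ (map_zero _)]
      exact h
    · rw [Matrix.map_add _ (map_add _), Matrix.map_mul, Matrix.map_mul, Matrix.transpose_map, map_adeleEval_lift_of_not_over L v Y u hu,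
        map_adeleEval_conj_lift_of_not_over L v Y u hu, Matrix.mul_zero, Matrix.transpose_zero, Matrix.zero_mul, add_zero,
        Matrix.map_zero _ (map_zero _)]

/-! ## §3 The letter `hb`: the hermitian dressing of the block coordinate is onto -/

/-- **LETTER `hb` OF ★ U2a AT THE PLACE `v`**: every `σ ⊗ 1`-hermitian `s ∈ M₂(L ⊗ L⁺_v)` is the dressing `b z = reindex ρ ρ (δ • X_v(z) T_v⁻¹)` of the block
coordinate of some local Siegel unipotent `z ∈ N_Δ(L⁺_v)` (`Y := (δ⁻¹ • reindex ρ⁻¹ ρ⁻¹ s) T_v` is `T_v`-skew, its place-`v` lift is `T_𝔸`-skew (§2) with zero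
archimedean part and no component off `v` (§1), ★ p863656 `exists_mem_unipDeltaLoc_toBlocks₁₂_eq` realises it as `X(ι_v z)`, and `δ δ⁻¹ = 1`, `Y T_v⁻¹ = δ⁻¹ • s′`).
[cite: GelbartPiatetskishapiroRallis1987, Part A §1] [cite: MoeglinWaldspurger1995, I.2.1] [cite: Scharlau1985HermitianForms, Ch. 10 §1] -/
theorem exists_unipDeltaLoc_dressing_eq (hdV0 : ∀ i, dV i ≠ 0) (hdW0 : ∀ i, dW i ≠ 0) (ρ : Fin n ≃ Fin 2)
    (s : Matrix (Fin 2) (Fin 2) (LocalRing L v)) (hs : (s.map (conjLocal L (IsCMField.complexConj L) v))ᵀ = s) :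
    ∃ z : ↥(unipDeltaLoc L e dV hdV dW hdW v),
      Matrix.reindex ρ ρ ((algebraMap L (LocalRing L v) (imagUnit L)) •
        ((((blk L e dV hdV dW hdW (locToAdelic L e dV hdV dW hdW v
            (z : UnitaryGroup.localPi L (IsCMField.complexConj L) (n + n) (hermD L e dV hdV dW hdW) v))).toBlocks₁₂).map
            (fun x : AdeleRing (𝓞 L) L => finiteAdeleToLocal L v x.2)) * (((gramR L e dV hdV dW hdW).map (algebraMap (Fp L) L)).map (algebraMap L (LocalRing L v)))⁻¹)) = s := by
  obtain ⟨hTc, hTt, hTu⟩ := localGram_map_conj_transpose_isUnit L e dV hdV dW hdW v hdV0 hdW0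
  -- `δ`, `d`, `δ⁻¹ = d⁻¹ δ`
  have hd0 : imagUnitSq L ≠ 0 := by
    intro h0
    have h := imagUnit_mul_self L
    rw [h0, map_zero, mul_self_eq_zero] at h
    exact imagUnit_ne_zero L h
  have hdv0 : ((imagUnitSq L : Fp L) : v.adicCompletion (Fp L)) ≠ 0 := fun h0 =>
    hd0 ((algebraMap (Fp L) (v.adicCompletion (Fp L))).injective (h0.trans (map_zero _).symm))
  have hδ2 : (algebraMap L (LocalRing L v) (imagUnit L)) * (algebraMap L (LocalRing L v) (imagUnit L)) = toLocalRing L v ((imagUnitSq L : Fp L) : v.adicCompletion (Fp L)) := by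
    rw [← map_mul, imagUnit_mul_self, ← toLocalRing_coe]
  have hδδinv : (algebraMap L (LocalRing L v) (imagUnit L)) * (toLocalRing L v (((imagUnitSq L : Fp L) : v.adicCompletion (Fp L)))⁻¹ * (algebraMap L (LocalRing L v) (imagUnit L))) = 1 := by
    rw [mul_left_comm, hδ2, ← map_mul, inv_mul_cancel₀ hdv0, map_one]
  have hσδinv : conjLocal L (IsCMField.complexConj L) v (toLocalRing L v (((imagUnitSq L : Fp L) : v.adicCompletion (Fp L)))⁻¹ * (algebraMap L (LocalRing L v) (imagUnit L))) = -(toLocalRing L v (((imagUnitSq L : Fp L) : v.adicCompletion (Fp L)))⁻¹ * (algebraMap L (LocalRing L v) (imagUnit L))) := by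
    rw [map_mul, conjLocal_toLocalRing, conjLocal_algebraMap, complexConj_imagUnit, map_neg, mul_neg]
  -- the hermitian `s′ := reindex ρ⁻¹ ρ⁻¹ s` and the `T_v`-skew `Y := (δ⁻¹ • s′) T_v`
  have hs' : ((Matrix.reindex ρ.symm ρ.symm s).map (conjLocal L (IsCMField.complexConj L) v))ᵀ = Matrix.reindex ρ.symm ρ.symm s :=
    K2LiuFinLineModelLettersAtPlace.map_transpose_reindex ρ.symm _ s hs
  have hYt : ((((toLocalRing L v (((imagUnitSq L : Fp L) : v.adicCompletion (Fp L)))⁻¹ * (algebraMap L (LocalRing L v) (imagUnit L))) • Matrix.reindex ρ.symm ρ.symm s) * (((gramR L e dV hdV dW hdW).map (algebraMap (Fp L) L)).map (algebraMap L (LocalRing L v)))).map (conjLocal L (IsCMField.complexConj L) v))ᵀ =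
      -((((gramR L e dV hdV dW hdW).map (algebraMap (Fp L) L)).map (algebraMap L (LocalRing L v))) * ((toLocalRing L v (((imagUnitSq L : Fp L) : v.adicCompletion (Fp L)))⁻¹ * (algebraMap L (LocalRing L v) (imagUnit L))) • Matrix.reindex ρ.symm ρ.symm s)) := by
    rw [Matrix.map_mul, Matrix.transpose_mul, hTc, hTt, Matrix.map_smul' _ _ _ (map_mul _), Matrix.transpose_smul, hσδinv, hs', neg_smul,
      Matrix.mul_neg]
  have hY : (((gramR L e dV hdV dW hdW).map (algebraMap (Fp L) L)).map (algebraMap L (LocalRing L v))) * (((toLocalRing L v (((imagUnitSq L : Fp L) : v.adicCompletion (Fp L)))⁻¹ * (algebraMap L (LocalRing L v) (imagUnit L))) • Matrix.reindex ρ.symm ρ.symm s) * (((gramR L e dV hdV dW hdW).map (algebraMap (Fp L) L)).map (algebraMap L (LocalRing L v)))) +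
      ((((toLocalRing L v (((imagUnitSq L : Fp L) : v.adicCompletion (Fp L)))⁻¹ * (algebraMap L (LocalRing L v) (imagUnit L))) • Matrix.reindex ρ.symm ρ.symm s) * (((gramR L e dV hdV dW hdW).map (algebraMap (Fp L) L)).map (algebraMap L (LocalRing L v)))).map (conjLocal L (IsCMField.complexConj L) v))ᵀ * (((gramR L e dV hdV dW hdW).map (algebraMap (Fp L) L)).map (algebraMap L (LocalRing L v))) = 0 := by
    rw [hYt, Matrix.neg_mul, ← Matrix.mul_assoc, add_neg_cancel]
  -- the chart
  obtain ⟨z, hz, -, hblk⟩ := exists_mem_unipDeltaLoc_toBlocks₁₂_eq L e dV hdV dW hdW v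
    ((((toLocalRing L v (((imagUnitSq L : Fp L) : v.adicCompletion (Fp L)))⁻¹ * (algebraMap L (LocalRing L v) (imagUnit L))) • Matrix.reindex ρ.symm ρ.symm s) * (((gramR L e dV hdV dW hdW).map (algebraMap (Fp L) L)).map (algebraMap L (LocalRing L v)))).map (fun y : LocalRing L v => ∑ w : UnitaryGroup.PlacesOver L v, adeleSingleHom L w.1 (y w)))
    (lift_skew L e dV hdV dW hdW v _ hY) (map_adeleFst_lift L v _) (fun w hw => map_adeleEval_lift_of_not_over L v _ w hw)
  refine ⟨⟨z, hz⟩, ?_⟩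
  have hXv : ((blk L e dV hdV dW hdW (locToAdelic L e dV hdV dW hdW v z)).toBlocks₁₂).map (fun x : AdeleRing (𝓞 L) L => finiteAdeleToLocal L v x.2) =
      ((toLocalRing L v (((imagUnitSq L : Fp L) : v.adicCompletion (Fp L)))⁻¹ * (algebraMap L (LocalRing L v) (imagUnit L))) • Matrix.reindex ρ.symm ρ.symm s) * (((gramR L e dV hdV dW hdW).map (algebraMap (Fp L) L)).map (algebraMap L (LocalRing L v))) := by
    rw [hblk, map_local_lift]
  rw [show ((⟨z, hz⟩ : ↥(unipDeltaLoc L e dV hdV dW hdW v)) :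
      UnitaryGroup.localPi L (IsCMField.complexConj L) (n + n) (hermD L e dV hdV dW hdW) v) = z from rfl, hXv, Matrix.mul_assoc,
    Matrix.mul_nonsing_inv _ hTu, Matrix.mul_one, smul_smul, hδδinv, one_smul, ← Matrix.reindex_symm]
  exact (Matrix.reindex ρ ρ).apply_symm_apply s

end Summit.HodgeConjecture.HodgeConjecture.Cruxes.HLiu418.K2LiuFinLineModelLettersAtPlaceB

end
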